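import Summits.AnomalousDissipation.AnomalousDissipation.Theorems.FloorCertificate.Negative.WeakDuality
import Summits.AnomalousDissipation.AnomalousDissipation.Theorems.FloorCertificate.Negative.InjectedBeatTools

/-!
# `TaylorCertificates.FloorCertificate` (stmt-AnomalousDissipation-14091) — negative side III:
# the FLOOR evaluated at the injected mode and at the injected beat state

cdisprove seat `refuter-cdisprove-stmt-AnomalousDissipation-14091-g2-0` (cycle 2), 2026-08-16. Two packaging
lemmas for `Negative/FixedResolution.lean`:

* `floor_at_mode` — at the single transversal mode `u₀ = Re(e_{k₀} z₀)` whose energy input dominates its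
  dissipation, the floor for a band-limited `Φ` and ANY weight `θ ≤ 0` reads
  `ε₀ ≤ ν‖∇u₀‖² + ‖f‖₂ 𝔊 + ν‖z₀‖4π²|k₀|² 𝔊` (`𝔊` = truncated coefficient norm of `Φ'(u₀)`): no
  self-interaction, and the injection signs the weight term away;
* `floor_at_injected_beat` — at `u₀ + Re(e_p zA) + Re(e_{p+q} zB)` with the waves outside the band the
  multiplier is unchanged (`coords_waves_invisible`), only the beat survives (`inertial_beat_gen`), and the
  floor reads `ε₀ ≤ ν‖∇u‖² + ‖f‖₂ 𝔊 + ν‖z₀‖4π²|k₀|² 𝔊 − gain`.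
-/

noncomputable section

set_option linter.dupNamespace false

open MeasureTheory UnitAddTorus Matrix Filter Topology
open scoped InnerProductSpace ENNReal ComplexConjugate

namespace Summit.AnomalousDissipation.AnomalousDissipation.Theorems.FloorCertificate.Negative

open Literature.Analysis.FunctionSpaces Literature.Analysis.FluidPDE
open Summit.AnomalousDissipation.AnomalousDissipation.Theses.TaylorCertificates
open Summit.AnomalousDissipation.AnomalousDissipation.Theorems.TaylorCertificatePair.Negative

/-! ### §F.6 The FLOOR at the injected mode and at the injected beat state -/

/-- **FLOOR at the injected mode.** If the floor holds at the single transversal mode `Re(e_{k₀} z₀)`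
whose energy input dominates its dissipation, then
`ε₀ ≤ ν‖∇u₀‖² + ‖f‖₂ 𝔊 + ν ‖z₀‖ 4π²|k₀|² 𝔊` (`𝔊` the truncated coefficient norm of `Φ'(u₀)`):
no self-interaction, and the weight term is signed away by the injection. -/
theorem floor_at_mode {f : (UnitAddTorus (Fin 3)) → (EuclideanSpace ℝ (Fin 3))} (hf : Torus.IsSmooth f) {ν : ℝ} (hν : 0 < ν)
    (Φ : Torus.CylindricalTest (Fin 3)) {N : ℕ} (hΦ : ∀ i, Torus.fourierTruncate N (Φ.g i) = Φ.g i)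
    {θ ε₀ : ℝ} (hθ : θ ≤ 0) {k₀ : Fin 3 → ℤ} {z₀ : (EuclideanSpace ℂ (Fin 3))}
    (hdz : ((fun j => ((k₀) j : ℂ)) ⬝ᵥ (WithLp.ofLp (z₀))) = 0)
    (ue : (Torus.energySpace (Fin 3)))
    (hue : (((ue : (Torus.energySpace (Fin 3))) : (Lp (EuclideanSpace ℝ (Fin 3)) 2 (volume : Measure (UnitAddTorus (Fin 3))))) : (UnitAddTorus (Fin 3)) → (EuclideanSpace ℝ (Fin 3))) =ᵐ[volume] (∑ mm, Torus.realTrigPoly {![k₀] mm} (fun _ => ![z₀] mm)))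
    (hball : ∫ x, ‖(∑ mm, Torus.realTrigPoly {![k₀] mm} (fun _ => ![z₀] mm)) x‖ ^ 2 ≤ 16 * (∫ x, ‖f x‖ ^ 2) / ν ^ 2)
    (hD : ν * (Torus.eGradNormSq ((∑ mm, Torus.realTrigPoly {![k₀] mm} (fun _ => ![z₀] mm)))).toReal ≤
      (⟪z₀, mFourierCoeff (EuclideanSpace.complexify ∘ f) k₀⟫_ℂ).re)
    (hfl : FloorIneq ν f Φ θ ε₀ ue) :
    ε₀ ≤ ν * (Torus.eGradNormSq ((∑ mm, Torus.realTrigPoly {![k₀] mm} (fun _ => ![z₀] mm)))).toReal +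
      Real.sqrt (∫ x, ‖f x‖ ^ 2) * (Real.sqrt (∑ κ' ∈ Torus.freqBall N, ‖mFourierCoeff (EuclideanSpace.complexify ∘ (Φ.grad ue)) κ'‖ ^ 2)) +
      ν * (‖z₀‖ * (4 * Real.pi ^ 2 * Torus.freqNormSq k₀) * (Real.sqrt (∑ κ' ∈ Torus.freqBall N, ‖mFourierCoeff (EuclideanSpace.complexify ∘ (Φ.grad ue)) κ'‖ ^ 2))) := by
  set G := Φ.grad ue with hGdef
  have hG : Torus.IsSmooth G := isSmooth_grad Φ ue
  have hband : ∀ κ, (N : ℝ) ^ 2 < Torus.freqNormSq κ →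
      mFourierCoeff (EuclideanSpace.complexify ∘ G) κ = 0 := fc_grad_eq_zero Φ hΦ ue
  have hfin : Torus.eGradNormSq (((ue : (Torus.energySpace (Fin 3))) : (Lp (EuclideanSpace ℝ (Fin 3)) 2 (volume : Measure (UnitAddTorus (Fin 3))))) : (UnitAddTorus (Fin 3)) → (EuclideanSpace ℝ (Fin 3))) ≠ ⊤ := by
    rw [eGradNormSq_congr_ae' hue]; exact eGradNormSq_modes_ne_top
  have hball' : ‖ue‖ ^ 2 ≤ 16 * (∫ x, ‖f x‖ ^ 2) / ν ^ 2 := by rw [norm_sq_of_ae hue]; exact hball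
  have h := hfl hfin hball'
  rw [nsGeneratorPairing_of_ae hue, pairing_of_ae hue, eGradNormSq_congr_ae' hue] at h
  -- (1) forcing term
  have h1 : ∫ x, ⟪f x, G x⟫_ℝ ≤ Real.sqrt (∫ x, ‖f x‖ ^ 2) * (Real.sqrt (∑ κ' ∈ Torus.freqBall N, ‖mFourierCoeff (EuclideanSpace.complexify ∘ G) κ'‖ ^ 2)) :=
    integral_inner_le_coeffNorm (hf.memLp 2) hG.continuous hband
  -- (2) Laplacian term
  have h2 := laplacian_one_le hG hband k₀ z₀
  have h2' := mul_le_mul_of_nonneg_left ((le_abs_self _).trans h2) hν.le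
  -- (3) no self-interaction
  have h3 := inertial_mode_zero hG k₀ z₀ hdz
  -- (4) the energy input
  have h4 : ∫ x, ⟪(∑ mm, Torus.realTrigPoly {![k₀] mm} (fun _ => ![z₀] mm)) x, f x⟫_ℝ =
      (⟪z₀, mFourierCoeff (EuclideanSpace.complexify ∘ f) k₀⟫_ℂ).re := by
    rw [integral_inner_modes_left hf.integrable]
    simp only [Fin.sum_univ_one, Matrix.cons_val_fin_one]
  have hPD : 0 ≤ (∫ x, ⟪(∑ mm, Torus.realTrigPoly {![k₀] mm} (fun _ => ![z₀] mm)) x, f x⟫_ℝ) -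
      ν * (Torus.eGradNormSq ((∑ mm, Torus.realTrigPoly {![k₀] mm} (fun _ => ![z₀] mm)))).toReal := by
    rw [h4]; linarith
  have hθterm : 2 * θ * ((∫ x, ⟪(∑ mm, Torus.realTrigPoly {![k₀] mm} (fun _ => ![z₀] mm)) x, f x⟫_ℝ) -
      ν * (Torus.eGradNormSq ((∑ mm, Torus.realTrigPoly {![k₀] mm} (fun _ => ![z₀] mm)))).toReal) ≤ 0 :=
    mul_nonpos_of_nonpos_of_nonneg (by linarith) hPD
  rw [h3] at h
  linarith

set_option maxHeartbeats 1000000 in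
/-- **FLOOR at the injected beat state.** If the floor holds at `Re(e_{k₀} z₀) + Re(e_p zA) + Re(e_{p+q} zB)`
with the waves outside the band and the energy input of the mode dominating the dissipation and the wave
pairings, then `ε₀ ≤ ν‖∇u‖² + ‖f‖₂ 𝔊 + ν ‖z₀‖ 4π²|k₀|² 𝔊 − gain`, where `−gain` bounds the beat. -/
theorem floor_at_injected_beat {f : (UnitAddTorus (Fin 3)) → (EuclideanSpace ℝ (Fin 3))} (hf : Torus.IsSmooth f) {ν : ℝ} (hν : 0 < ν)
    (Φ : Torus.CylindricalTest (Fin 3)) {N : ℕ} (hΦ : ∀ i, Torus.fourierTruncate N (Φ.g i) = Φ.g i)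
    {θ ε₀ : ℝ} (hθ : θ ≤ 0) {k₀ p q : Fin 3 → ℤ} {z₀ zA zB : (EuclideanSpace ℂ (Fin 3))}
    (hdz : ((fun j => ((k₀) j : ℂ)) ⬝ᵥ (WithLp.ofLp (z₀))) = 0)
    (hA : ((fun j => ((p) j : ℂ)) ⬝ᵥ (WithLp.ofLp (zA))) = 0)
    (hB : ((fun j => (((p + q)) j : ℂ)) ⬝ᵥ (WithLp.ofLp (zB))) = 0)
    (ue : (Torus.energySpace (Fin 3)))
    (hue : (((ue : (Torus.energySpace (Fin 3))) : (Lp (EuclideanSpace ℝ (Fin 3)) 2 (volume : Measure (UnitAddTorus (Fin 3))))) : (UnitAddTorus (Fin 3)) → (EuclideanSpace ℝ (Fin 3))) =ᵐ[volume] (∑ mm, Torus.realTrigPoly {![k₀] mm} (fun _ => ![z₀] mm)))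
    (uw : (Torus.energySpace (Fin 3)))
    (huw : (((uw : (Torus.energySpace (Fin 3))) : (Lp (EuclideanSpace ℝ (Fin 3)) 2 (volume : Measure (UnitAddTorus (Fin 3))))) : (UnitAddTorus (Fin 3)) → (EuclideanSpace ℝ (Fin 3))) =ᵐ[volume] (∑ mm, Torus.realTrigPoly {![k₀, p, p + q] mm} (fun _ => ![z₀, zA, zB] mm)))
    (hNp : (N : ℝ) ^ 2 < Torus.freqNormSq p) (hNpq : (N : ℝ) ^ 2 < Torus.freqNormSq (p + q))
    (hN1 : (N : ℝ) ^ 2 < Torus.freqNormSq (p + k₀)) (hN2 : (N : ℝ) ^ 2 < Torus.freqNormSq (p - k₀))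
    (hN3 : (N : ℝ) ^ 2 < Torus.freqNormSq (p + q + k₀)) (hN4 : (N : ℝ) ^ 2 < Torus.freqNormSq (p + q - k₀))
    (hN5 : (N : ℝ) ^ 2 < Torus.freqNormSq (p + (p + q)))
    (hAq : ⟪(mFourierCoeff (EuclideanSpace.complexify ∘ (Φ.grad ue)) (-q)), zA⟫_ℂ = 0)
    {gain : ℝ}
    (hbeat : Real.pi * (conj (((fun j => ((q) j : ℂ)) ⬝ᵥ (WithLp.ofLp (zA)))) * ⟪(mFourierCoeff (EuclideanSpace.complexify ∘ (Φ.grad ue)) q), zB⟫_ℂ).im ≤ -gain)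
    (hball : ∫ x, ‖(∑ mm, Torus.realTrigPoly {![k₀, p, p + q] mm} (fun _ => ![z₀, zA, zB] mm)) x‖ ^ 2 ≤ 16 * (∫ x, ‖f x‖ ^ 2) / ν ^ 2)
    (hD : ν * (Torus.eGradNormSq ((∑ mm, Torus.realTrigPoly {![k₀, p, p + q] mm} (fun _ => ![z₀, zA, zB] mm)))).toReal ≤
      (⟪z₀, mFourierCoeff (EuclideanSpace.complexify ∘ f) k₀⟫_ℂ).re - ‖zA‖ * Real.sqrt (∫ x, ‖f x‖ ^ 2) - ‖zB‖ * Real.sqrt (∫ x, ‖f x‖ ^ 2))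
    (hfl : FloorIneq ν f Φ θ ε₀ uw) :
    ε₀ ≤ ν * (Torus.eGradNormSq ((∑ mm, Torus.realTrigPoly {![k₀, p, p + q] mm} (fun _ => ![z₀, zA, zB] mm)))).toReal +
      Real.sqrt (∫ x, ‖f x‖ ^ 2) * (Real.sqrt (∑ κ' ∈ Torus.freqBall N, ‖mFourierCoeff (EuclideanSpace.complexify ∘ (Φ.grad ue)) κ'‖ ^ 2)) +
      ν * (‖z₀‖ * (4 * Real.pi ^ 2 * Torus.freqNormSq k₀) * (Real.sqrt (∑ κ' ∈ Torus.freqBall N, ‖mFourierCoeff (EuclideanSpace.complexify ∘ (Φ.grad ue)) κ'‖ ^ 2))) - gain := by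
  set G := Φ.grad ue with hGdef
  have hG : Torus.IsSmooth G := isSmooth_grad Φ ue
  have hband : ∀ κ, (N : ℝ) ^ 2 < Torus.freqNormSq κ →
      mFourierCoeff (EuclideanSpace.complexify ∘ G) κ = 0 := fc_grad_eq_zero Φ hΦ ue
  have hband' : ∀ κ, (N : ℝ) ^ 2 < Torus.freqNormSq κ → (mFourierCoeff (EuclideanSpace.complexify ∘ G) κ) = 0 := hband
  -- the beat state has the same differential
  have hgrad : Φ.grad uw = G := by
    rw [hGdef]
    exact grad_eq_of_coords_eq Φ (coords_waves_invisible Φ hΦ hNp hNpq huw hue)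
  have hfin : Torus.eGradNormSq (((uw : (Torus.energySpace (Fin 3))) : (Lp (EuclideanSpace ℝ (Fin 3)) 2 (volume : Measure (UnitAddTorus (Fin 3))))) : (UnitAddTorus (Fin 3)) → (EuclideanSpace ℝ (Fin 3))) ≠ ⊤ := by
    rw [eGradNormSq_congr_ae' huw]; exact eGradNormSq_modes_ne_top
  have hball' : ‖uw‖ ^ 2 ≤ 16 * (∫ x, ‖f x‖ ^ 2) / ν ^ 2 := by rw [norm_sq_of_ae huw]; exact hball
  have h := hfl hfin hball'
  rw [hgrad, nsGeneratorPairing_of_ae huw, pairing_of_ae huw, eGradNormSq_congr_ae' huw] at h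
  -- (1) forcing term
  have h1 : ∫ x, ⟪f x, G x⟫_ℝ ≤ Real.sqrt (∫ x, ‖f x‖ ^ 2) * (Real.sqrt (∑ κ' ∈ Torus.freqBall N, ‖mFourierCoeff (EuclideanSpace.complexify ∘ G) κ'‖ ^ 2)) :=
    integral_inner_le_coeffNorm (hf.memLp 2) hG.continuous hband
  -- (2) Laplacian term: the waves do not contribute
  have h2 := laplacian_three_le hG hband k₀ z₀ zA zB (hband' p hNp) (hband' (p + q) hNpq)
  have h2' := mul_le_mul_of_nonneg_left ((le_abs_self _).trans h2) hν.le
  -- (3) the beat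
  have h3 : ∫ x, ⟪Torus.fderiv G x ((∑ mm, Torus.realTrigPoly {![k₀, p, p + q] mm} (fun _ => ![z₀, zA, zB] mm)) x),
      (∑ mm, Torus.realTrigPoly {![k₀, p, p + q] mm} (fun _ => ![z₀, zA, zB] mm)) x⟫_ℝ ≤ -gain := by
    rw [inertial_beat_gen hG k₀ p q z₀ zA zB hdz hA hB
      (hband' _ (by rwa [add_comm])) (hband' _ hN2) (hband' _ hN1)
      (hband' _ (by rwa [← neg_sub, Torus.freqNormSq_neg])) (hband' _ (by rwa [add_comm]))
      (hband' _ hN4) (hband' _ hN3) (hband' _ (by rwa [← neg_sub, Torus.freqNormSq_neg]))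
      (hband' _ hN5) (hband' _ (by rwa [add_comm])) hAq]
    exact hbeat
  -- (4) the energy input exceeds the dissipation: the weight term is signed away
  have h4 : ∫ x, ⟪(∑ mm, Torus.realTrigPoly {![k₀, p, p + q] mm} (fun _ => ![z₀, zA, zB] mm)) x, f x⟫_ℝ =
      (⟪z₀, mFourierCoeff (EuclideanSpace.complexify ∘ f) k₀⟫_ℂ).re +
        (⟪zA, mFourierCoeff (EuclideanSpace.complexify ∘ f) p⟫_ℂ).re +
        (⟪zB, mFourierCoeff (EuclideanSpace.complexify ∘ f) (p + q)⟫_ℂ).re := by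
    rw [integral_inner_modes_left hf.integrable]
    simp only [Fin.sum_univ_three, Matrix.cons_val_zero, Matrix.cons_val_one, Matrix.cons_val_two,
      Matrix.head_cons, Matrix.tail_cons, Fin.isValue]
  have hwA : |(⟪zA, mFourierCoeff (EuclideanSpace.complexify ∘ f) p⟫_ℂ).re| ≤ ‖zA‖ * Real.sqrt (∫ x, ‖f x‖ ^ 2) :=
    (abs_re_inner_le_norm_mul _ _).trans (mul_le_mul_of_nonneg_left (norm_fc_le_sqrt_integral (hf.memLp 2) _) (norm_nonneg _))
  have hwB : |(⟪zB, mFourierCoeff (EuclideanSpace.complexify ∘ f) (p + q)⟫_ℂ).re| ≤ ‖zB‖ * Real.sqrt (∫ x, ‖f x‖ ^ 2) :=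
    (abs_re_inner_le_norm_mul _ _).trans (mul_le_mul_of_nonneg_left (norm_fc_le_sqrt_integral (hf.memLp 2) _) (norm_nonneg _))
  have hwA' := neg_abs_le (⟪zA, mFourierCoeff (EuclideanSpace.complexify ∘ f) p⟫_ℂ).re
  have hwB' := neg_abs_le (⟪zB, mFourierCoeff (EuclideanSpace.complexify ∘ f) (p + q)⟫_ℂ).re
  have hPD : 0 ≤ (∫ x, ⟪(∑ mm, Torus.realTrigPoly {![k₀, p, p + q] mm} (fun _ => ![z₀, zA, zB] mm)) x, f x⟫_ℝ) -
      ν * (Torus.eGradNormSq ((∑ mm, Torus.realTrigPoly {![k₀, p, p + q] mm} (fun _ => ![z₀, zA, zB] mm)))).toReal := by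
    rw [h4]; linarith
  have hθterm : 2 * θ * ((∫ x, ⟪(∑ mm, Torus.realTrigPoly {![k₀, p, p + q] mm} (fun _ => ![z₀, zA, zB] mm)) x, f x⟫_ℝ) -
      ν * (Torus.eGradNormSq ((∑ mm, Torus.realTrigPoly {![k₀, p, p + q] mm} (fun _ => ![z₀, zA, zB] mm)))).toReal) ≤ 0 :=
    mul_nonpos_of_nonpos_of_nonneg (by linarith) hPD
  linarith

end Summit.AnomalousDissipation.AnomalousDissipation.Theorems.FloorCertificate.Negative
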